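import Summits.HodgeConjecture.CorCM.OcticCurveFourfoldHodgeOfMarkman
import Summits.HodgeConjecture.CorCM.Model.CMAbelianVarietyRealisedHolds
import Summits.HodgeConjecture.CorCM.CurveTimesMultiquadraticCMWeights
import HarnessLib

/-!
# COR-CM — ONE copy of the curve: the Hodge conjecture for `B^n × E` and for all powers `B^n` of a CM abelian fourfold `B`
# whose octic CM field contains the CM field `k` of `E` with `k`-signature `(1,3)` — UNCONDITIONALLY (divisor classes only)

Cell `pub-hodgecm2` (COR-CM), seat b30 gen 18 (2026-08-21); count-neutral own lane OCTIC-EB, unconditional corollary.  Theorems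
only, no definition, no named fact, no `sorry`.  HONEST FRAMING: this is NOT `HC_CM` and not a step towards it; it is the
«nothing happens yet» half of the octic one-curve slice, recorded because it is free.

THE POINT.  By the DEFECT LAW of `Census/OcticCurveFourfold` (`e_τ − e_τ̄ = 2t`, `N(s) − N(s̄) = t`), a balanced weight with AT
MOST ONE point over each curve label has `t = 0`: it is a disjoint union of conjugate pairs (divisor weights).  A product of
copies `⨁_j A₂(κ j)` with AT MOST ONE curve slot (`B^n`, or `B^n × E`) has no Weil part — a Weil part needs its two curve points
in two DIFFERENT copies of `E` (`IsWeilPart.exists_pair`) — so the assembly of `CorCM/OcticCurveFourfoldPowersHodgeOfMarkman`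
runs WITHOUT the Weil plane and WITHOUT Markman's theorem:

* `hodgeConjectureFor_biproduct_comp_of_frame_of_atMostOneCurve` (frame form) and
  **`hodgeConjectureFor_biproduct_comp_vec_of_atMostOneCurve`** (intrinsic form): `K` ANY CM field with `[K:ℚ] = 8`, `k`
  quadratic, `i : k → K`, `B ⊨ (K; Φ)`, `E ⊨ (k; Ψ)`, `τ ∈ Ψ`, `#{s ∈ Φ | s ∘ i = τ} = 1`, and `κ : Fin N → Fin 2` taking the
  value `1` (the curve) AT MOST ONCE ⟹ `HodgeConjectureFor (⨁_j ![B, E] (κ j))`, UNCONDITIONALLY; in particular every power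
  `B^n` (such fourfolds are STABLY NONDEGENERATE: the Hodge ring of every power is generated by divisor classes — for `B`
  simple compare Moonen–Zarhin's theorem on simple fourfolds — exceptional Hodge classes only in the Weil-type case —, here for
  all powers, with no simplicity hypothesis and with one curve factor allowed) and every `B^n × E` (Moonen–Zarhin's `X × E_k`, `X` not of Weil type, for all powers of `X`);
* `hodgeConjectureFor_prod_of_atMostOneCurve` — the fivefold `B × E` itself;
* §3 NON-VACUITY: `exists_cmType_card_filter_eq_one`, `exists_fourfold_of_signature_one_three` — over every octic CM field
  `K ⊇ k` the data `(Φ, B)` of all these theorems exist (the tree's `CorCM.cmAbelianVarietyRealised_holds`).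
The SECOND copy of `E` is exactly where the Weil class of `B × E × E` appears (`CorCM/OcticCurveFourfoldHodgeOfMarkman`, modulo
Markman; seat b25's `CurveTimesMultiquadraticCMSquare`: product span fails on `E² × Y`).
[cite: Pohlmann1968, Thm 1] [cite: MoonenZarhin1999LowDim, Thm. 0.1 (a)] [cite: MoonenZarhin1995Duke, main theorem]
[cite: Gordon1999HodgeAVSurvey, 9.2.2]

## References
* [Pohlmann1968] H. Pohlmann, Ann. of Math. 88 (1968), Thm 1.  [MoonenZarhin1999LowDim] B. Moonen, Yu. Zarhin, Math. Ann. 315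
  (1999), Thm. 0.1 (a).  [MoonenZarhin1995Duke] B. Moonen, Yu. Zarhin, *Hodge classes and Tate classes on simple abelian
  fourfolds*, Duke Math. J. 77 (1995), main theorem (exceptional classes on a simple fourfold only in the Weil-type case).  [Gordon1999HodgeAVSurvey] B. B. Gordon, CRM Monogr. 10 (1999), 9.2.2.
-/

noncomputable section

open CategoryTheory CategoryTheory.Limits NumberField

namespace Summit.HodgeConjecture.CorCM.OcticCurveFourfold

open Literature.AlgebraicGeometry Literature.AlgebraicGeometry.Motives Literature.AlgebraicGeometry.HodgeTheory
open Literature.AlgebraicGeometry.ComplexMultiplication (IsCMTypeRealisation)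
open Literature.AlgebraicGeometry.Pohlmann1968
open Literature.AlgebraicTopology.SingularHomology
open Summit.HodgeConjecture.CorCM.Census.OcticCurveFourfold (Pt phi phiPre ModelBalanced IsPairPart IsWeilPart
  modelBalanced_induction)
open Summit.HodgeConjecture.CorCM.DecicCurveFivefold (curveSlots₂ sigma_cases)
open Summit.HodgeConjecture.CorCM.PairWeights
open Summit.HodgeConjecture.CorCM.NonGaloisField (conjugate_comp)

open scoped Classical Pointwise

/-! ## §1 Frame form: no Weil part, hence no Weil plane needed -/

section Frame

variable {I : Type} {Kf : I → Type} [∀ i, Field (Kf i)] [∀ i, NumberField (Kf i)] [∀ i, IsCMField (Kf i)]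
  {i₀ i₁ : I} {N : ℕ} {e : (Kf i₁ →+* ℂ) ≃ Fin 4 × Bool} {τ : Kf i₀ →+* ℂ} {i : Kf i₀ →+* Kf i₁}
  {A₂ : Fin 2 → AbelianVariety ℂ} {Φ₂ : ∀ j : Fin 2, CMType (Kf (curveSlots₂ i₀ i₁ j))}
  {ι₂ : ∀ j, 𝓞 (Kf (curveSlots₂ i₀ i₁ j)) →+* End (A₂ j)}
  {θ₂ : ∀ j, Kf (curveSlots₂ i₀ i₁ j) →+* Module.End ℂ (complexBetti (A₂ j).X 1)}

omit [∀ i, NumberField (Kf i)] [∀ i, IsCMField (Kf i)] in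
/-- **With at most one curve slot there is no Weil part**: a Weil part has two distinct curve points over the same label,
which lie in two different copies of `E` (`IsWeilPart.exists_pair`). [folklore] -/
theorem not_isWeilPart_of_atMostOneCurve (hk : ∀ σ : Kf i₀ →+* ℂ, σ = τ ∨ σ = ComplexEmbedding.conjugate τ)
    (κ : Fin N → Fin 2) (hκ : ∀ j j' : Fin N, κ j = (0 : Fin 1).succ → κ j' = (0 : Fin 1).succ → j = j')
    {b : Bool} {G : Finset ((j : Fin N) × (Kf (curveSlots₂ i₀ i₁ (κ j)) →+* ℂ))}
    (hG : IsWeilPart (fun x => toPt e τ ((Sigma.map κ (fun _ => id) :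
      ((j : Fin N) × (Kf (curveSlots₂ i₀ i₁ (κ j)) →+* ℂ)) → ((m : Fin 2) × (Kf (curveSlots₂ i₀ i₁ m) →+* ℂ))) x)) b G) :
    False := by
  obtain ⟨x₁, -, x₂, -, hne, hv₁, hv₂⟩ := hG.exists_pair
  obtain ⟨σ₁, hσ₁, hσ₁'⟩ := fst_eq_one_of_toPt_eq_inl hk (x := ⟨κ x₁.1, x₁.2⟩) hv₁
  obtain ⟨σ₂, hσ₂, hσ₂'⟩ := fst_eq_one_of_toPt_eq_inl hk (x := ⟨κ x₂.1, x₂.2⟩) hv₂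
  have hj : x₁.1 = x₂.1 := hκ _ _ (congrArg Sigma.fst hσ₁) (congrArg Sigma.fst hσ₂)
  apply hne
  have h1 : (⟨κ x₁.1, x₁.2⟩ : (m : Fin 2) × (Kf (curveSlots₂ i₀ i₁ m) →+* ℂ)) = ⟨κ x₂.1, x₂.2⟩ := by
    rw [hσ₁, hσ₂, hσ₁', hσ₂']
  obtain ⟨j₁, s₁⟩ := x₁
  obtain ⟨j₂, s₂⟩ := x₂
  change j₁ = j₂ at hj
  subst hj
  simp only [Sigma.mk.injEq, heq_eq_eq, true_and] at h1 ⊢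
  exact h1

/-- **`HodgeConjectureFor (⨁_j A₂ (κ j))` for slot maps with AT MOST ONE curve slot, UNCONDITIONALLY** (frame form): every
balanced configuration is a disjoint union of pair parts (the Weil step of the induction is vacuous), and pair parts have
divisor lines. [cite: Pohlmann1968, Thm 1] [cite: Gordon1999HodgeAVSurvey, 9.2.2] [cite: MoonenZarhin1999LowDim, Thm. 0.1 (a)] -/
theorem hodgeConjectureFor_biproduct_comp_of_frame_of_atMostOneCurve (κ : Fin N → Fin 2)
    (hκ : ∀ j j' : Fin N, κ j = (0 : Fin 1).succ → κ j' = (0 : Fin 1).succ → j = j')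
    (hττ : ComplexEmbedding.conjugate τ ≠ τ) (hk : ∀ σ : Kf i₀ →+* ℂ, σ = τ ∨ σ = ComplexEmbedding.conjugate τ)
    (hA : ∀ j, IsCMTypeRealisation (Φ₂ j) (A₂ j) (ι₂ j) (θ₂ j))
    (he_sign : ∀ s : Kf i₁ →+* ℂ, (e s).2 = true ↔ s.comp i = τ)
    (he_conj : ∀ s : Kf i₁ →+* ℂ, e (ComplexEmbedding.conjugate s) = ((e s).1, !(e s).2))
    (hΦ : ∀ s : Kf i₁ →+* ℂ, s ∈ (Φ₂ 0).1 ↔ Sum.inr (e s) ∈ phi)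
    (hΨ : ∀ σ : Kf i₀ →+* ℂ, σ ∈ (Φ₂ (0 : Fin 1).succ).1 ↔ σ = τ) :
    HodgeConjectureFor (⨁ fun j => A₂ (κ j)).dim (⨁ fun j => A₂ (κ j)).X := by
  refine ⟨nonempty_hodgeModel_holds (Motives.AbelianVariety.isSmoothProjective_holds (A := ⨁ fun j => A₂ (κ j))),
    fun p c hc hH => ?_⟩
  have hAκ : ∀ j, IsCMTypeRealisation (Φ₂ (κ j)) (A₂ (κ j)) (ι₂ (κ j)) (θ₂ (κ j)) := fun j => hA (κ j)
  have key : ∀ (R : Finset ((j : Fin N) × (Kf (curveSlots₂ i₀ i₁ (κ j)) →+* ℂ))),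
      ModelBalanced (fun x => toPt e τ ((Sigma.map κ (fun _ => id) :
        ((j : Fin N) × (Kf (curveSlots₂ i₀ i₁ (κ j)) →+* ℂ)) → ((m : Fin 2) × (Kf (curveSlots₂ i₀ i₁ m) →+* ℂ))) x)) R →
      ∀ q, R.card = 2 * q → weightClassesAlg (fun j => A₂ (κ j)) (fun j => ι₂ (κ j)) (2 * q) R ≤
        algebraicClasses (⨁ fun j => A₂ (κ j)).X q := by
    intro R hR
    refine modelBalanced_induction (motive := fun R => ∀ q, R.card = 2 * q →
      weightClassesAlg (fun j => A₂ (κ j)) (fun j => ι₂ (κ j)) (2 * q) R ≤ algebraicClasses (⨁ fun j => A₂ (κ j)).X q)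
      (fun q hq => ?_) (fun G R hGR hG ih q hq => ?_) (fun G R b hGR hG ih q hq => ?_) hR
    · obtain rfl : q = 0 := by simpa using hq.symm
      exact fun c _ => hodgeConjectureFor_codim_zero c
    · obtain ⟨ha, hGalg⟩ := weightClassesAlg_le_algebraicClasses_of_isPairPart κ hττ hk he_conj hA hG
      have hRcard : R.card = 2 * (q - 1) := by
        have h := Finset.card_union_of_disjoint hGR
        rw [hq, ha] at h
        omega
      have haq : 1 + (q - 1) = q := by
        have h := Finset.card_union_of_disjoint hGR
        rw [hq, ha] at h
        omega
      rw [← Finset.disjUnion_eq_union G R hGR]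
      exact weightClassesAlg_union_le_algebraicClasses hAκ haq ha hRcard hGR hGalg (ih (q - 1) hRcard)
    · exact (not_isWeilPart_of_atMostOneCurve hk κ hκ hG).elim
  have hmem : c ∈ ⨆ S ∈ pohlmannSetsAlg (K := fun j => Kf (curveSlots₂ i₀ i₁ (κ j))) (fun j => Φ₂ (κ j)) p,
      weightClassesAlg (fun j => A₂ (κ j)) (fun j => ι₂ (κ j)) (2 * p) S := by
    rw [← (Pohlmann1968_thm1_cmAlgebra (fun j => Kf (curveSlots₂ i₀ i₁ (κ j))) (fun j => A₂ (κ j))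
      (fun j => Φ₂ (κ j)) (fun j => ι₂ (κ j)) (fun j => θ₂ (κ j)) hAκ p).1]
    exact Submodule.subset_span ⟨hc, hH⟩
  have hle : (⨆ S ∈ pohlmannSetsAlg (K := fun j => Kf (curveSlots₂ i₀ i₁ (κ j))) (fun j => Φ₂ (κ j)) p,
      weightClassesAlg (fun j => A₂ (κ j)) (fun j => ι₂ (κ j)) (2 * p) S) ≤
      algebraicClasses (⨁ fun j => A₂ (κ j)).X p := by
    refine iSup₂_le fun S hS => ?_
    exact key S (modelBalanced_of_isGaloisBalancedAlg hττ hk he_sign he_conj hΦ hΨ κ hS.2) p hS.1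
  exact hle hmem

end Frame

/-! ## §2 Intrinsic form -/

section Main

variable {K : Type} [Field K] [NumberField K] [IsCMField K] {k : Type} [Field k] [NumberField k] [IsCMField k]
  {N : ℕ} {Φ : CMType K} {B : AbelianVariety ℂ} {ιB : 𝓞 K →+* End B} {θB : K →+* Module.End ℂ (complexBetti B.X 1)}
  {Ψ : CMType k} {E : AbelianVariety ℂ} {ιE : 𝓞 k →+* End E} {θE : k →+* Module.End ℂ (complexBetti E.X 1)}

/-- **THE HODGE CONJECTURE FOR `B^n × E` AND FOR `B^n`, UNCONDITIONALLY** (intrinsic form).  `K` ANY CM field of degree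
`8`, `k` quadratic, `i : k → K`; `B ⊨ (K; Φ)` a CM abelian fourfold and `E ⊨ (k; Ψ)` a CM elliptic curve (realisations on
`H¹`) with `τ ∈ Ψ` and `#{s ∈ Φ | s ∘ i = τ} = 1` (`k`-signature `(1,3)`); `κ : Fin N → Fin 2` a slot map taking the curve
value `1` at most once.  Then every rational `(q,q)`-class on `⨁_j ![B, E] (κ j)` is algebraic — no hypothesis, no named
fact: the Hodge ring is generated by divisor classes. [cite: Pohlmann1968, Thm 1] [cite: MoonenZarhin1999LowDim, Thm. 0.1 (a)]
[cite: MoonenZarhin1995Duke, main theorem] -/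
theorem hodgeConjectureFor_biproduct_comp_vec_of_atMostOneCurve
    (h8 : Module.finrank ℚ K = 8) (h2 : Module.finrank ℚ k = 2) (i : k →+* K)
    (hB : IsCMTypeRealisation Φ B ιB θB) (hE : IsCMTypeRealisation Ψ E ιE θE)
    {τ : k →+* ℂ} (hτΨ : τ ∈ Ψ.1)
    (h13 : (Finset.univ.filter fun s : K →+* ℂ => s.comp i = τ ∧ s ∈ Φ.1).card = 1)
    (κ : Fin N → Fin 2) (hκ : ∀ j j' : Fin N, κ j = 1 → κ j' = 1 → j = j') :
    HodgeConjectureFor (⨁ fun j => (![B, E] : Fin 2 → AbelianVariety ℂ) (κ j)).dim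
      (⨁ fun j => (![B, E] : Fin 2 → AbelianVariety ℂ) (κ j)).X := by
  have hττ : ComplexEmbedding.conjugate τ ≠ τ := Pohlmann1968.conjugate_ne_self Ψ τ
  have hk : ∀ σ : k →+* ℂ, σ = τ ∨ σ = ComplexEmbedding.conjugate τ := fun σ =>
    Multiquadratic.eq_or_eq_conjugate Ψ h2 τ σ
  have hΨ : ∀ σ : k →+* ℂ, σ ∈ Ψ.1 ↔ σ = τ := by
    intro σ
    rcases hk σ with rfl | rfl
    · exact ⟨fun _ => rfl, fun _ => hτΨ⟩
    · exact ⟨fun h => absurd h ((Ψ.2 τ).1 hτΨ), fun h => absurd h hττ⟩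
  obtain ⟨e, he_sign, he_conj, hΦ⟩ := exists_frame h8 h2 i hττ hk Φ h13
  let Kf : Fin 2 → Type := Fin.cons k fun _ : Fin 1 => K
  letI instF : ∀ j, Field (Kf j) := fun j =>
    Fin.cases (motive := fun j => Field (Kf j)) ‹Field k› (fun _ => ‹Field K›) j
  letI instN : ∀ j, NumberField (Kf j) := fun j =>
    Fin.cases (motive := fun j => NumberField (Kf j)) ‹NumberField k› (fun _ => ‹NumberField K›) j
  haveI instC : ∀ j, IsCMField (Kf j) := fun j =>
    Fin.cases (motive := fun j => IsCMField (Kf j)) ‹IsCMField k› (fun _ => ‹IsCMField K›) j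
  exact hodgeConjectureFor_biproduct_comp_of_frame_of_atMostOneCurve (Kf := Kf) (i₀ := 0) (i₁ := 1)
    (A₂ := ![B, E]) (Φ₂ := Fin.cons Φ (Fin.cons Ψ finZeroElim)) (ι₂ := Fin.cons ιB (Fin.cons ιE finZeroElim))
    (θ₂ := Fin.cons θB (Fin.cons θE finZeroElim)) κ hκ hττ hk (Fin.cases hB (Fin.cases hE fun l => l.elim0))
    he_sign he_conj hΦ hΨ

/-- **Every power `B^{n}` (here `⨁_{j<n} B`), UNCONDITIONALLY**: a CM abelian fourfold whose octic CM field contains an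
imaginary quadratic field with `k`-signature `(1,3)` is stably nondegenerate — the Hodge ring of every power is generated by
divisor classes. [cite: MoonenZarhin1995Duke, main theorem] [cite: Pohlmann1968, Thm 1] -/
theorem hodgeConjectureFor_pow_of_signature_one_three
    (h8 : Module.finrank ℚ K = 8) (h2 : Module.finrank ℚ k = 2) (i : k →+* K)
    (hB : IsCMTypeRealisation Φ B ιB θB) (hE : IsCMTypeRealisation Ψ E ιE θE)
    {τ : k →+* ℂ} (hτΨ : τ ∈ Ψ.1)
    (h13 : (Finset.univ.filter fun s : K →+* ℂ => s.comp i = τ ∧ s ∈ Φ.1).card = 1) (n : ℕ) :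
    HodgeConjectureFor (⨁ fun _ : Fin n => B).dim (⨁ fun _ : Fin n => B).X :=
  hodgeConjectureFor_biproduct_comp_vec_of_atMostOneCurve h8 h2 i hB hE hτΨ h13 (fun _ : Fin n => (0 : Fin 2))
    fun _ _ h _ => absurd h (by decide)

/-- **Everything dominated by some `B^n × E`** (one curve copy), UNCONDITIONALLY. [cite: MumfordAV1970, §19]
[cite: MoonenZarhin1999LowDim, Thm. 0.1 (a)] -/
theorem hodgeConjectureFor_of_avDominatedBy_comp_vec_of_atMostOneCurve
    (h8 : Module.finrank ℚ K = 8) (h2 : Module.finrank ℚ k = 2) (i : k →+* K)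
    (hB : IsCMTypeRealisation Φ B ιB θB) (hE : IsCMTypeRealisation Ψ E ιE θE)
    {τ : k →+* ℂ} (hτΨ : τ ∈ Ψ.1)
    (h13 : (Finset.univ.filter fun s : K →+* ℂ => s.comp i = τ ∧ s ∈ Φ.1).card = 1)
    (κ : Fin N → Fin 2) (hκ : ∀ j j' : Fin N, κ j = 1 → κ j' = 1 → j = j')
    {C : AbelianVariety ℂ} (hC : Domination.AVDominatedBy C (⨁ fun j => (![B, E] : Fin 2 → AbelianVariety ℂ) (κ j))) :
    HodgeConjectureFor C.dim C.X :=
  Domination.hodgeConjectureFor_of_avDominatedBy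
    (hodgeConjectureFor_biproduct_comp_vec_of_atMostOneCurve h8 h2 i hB hE hτΨ h13 κ hκ) hC

/-- **The fivefold `B × E` itself, UNCONDITIONALLY** (Moonen–Zarhin's `X × E_k` with `X` a CM fourfold not of Weil type:
divisor classes only): `⨁_j ![B, E] j ≅ B × E`. [cite: MoonenZarhin1999LowDim, Thm. 0.1 (a)] [cite: vanGeemen1994HodgeAV, 3.7] -/
theorem hodgeConjectureFor_prod_of_atMostOneCurve
    (h8 : Module.finrank ℚ K = 8) (h2 : Module.finrank ℚ k = 2) (i : k →+* K)
    (hB : IsCMTypeRealisation Φ B ιB θB) (hE : IsCMTypeRealisation Ψ E ιE θE)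
    {τ : k →+* ℂ} (hτΨ : τ ∈ Ψ.1)
    (h13 : (Finset.univ.filter fun s : K →+* ℂ => s.comp i = τ ∧ s ∈ Φ.1).card = 1) :
    HodgeConjectureFor (B.prod E).dim (B.prod E).X := by
  have h := hodgeConjectureFor_biproduct_comp_vec_of_atMostOneCurve h8 h2 i hB hE hτΨ h13 (id : Fin 2 → Fin 2)
    fun _ _ h h' => h.trans h'.symm
  exact hodgeConjectureFor_prod_of_biproduct (A := (![B, E] : Fin 2 → AbelianVariety ℂ)) h

end Main

/-! ## §3 Non-vacuity: the hypotheses of the OCTIC-EB theorems are inhabited over every octic CM field containing `k` -/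

section NonVacuity

variable {K : Type} [Field K] [NumberField K] [IsCMField K] {k : Type} [Field k] [NumberField k] [IsCMField k]

omit [IsCMField K] [IsCMField k] in
/-- **A CM type of `k`-signature `(1,3)` exists** on every CM field `K` of degree `8` receiving the quadratic `k`: take one
embedding `s₊` over `τ` and the conjugates of the other three. [cite: Shimura1998, §18.2 Lemma] -/
theorem exists_cmType_card_filter_eq_one (h8 : Module.finrank ℚ K = 8) (h2 : Module.finrank ℚ k = 2) (i : k →+* K)
    {τ : k →+* ℂ} (hττ : ComplexEmbedding.conjugate τ ≠ τ)
    (hk : ∀ σ : k →+* ℂ, σ = τ ∨ σ = ComplexEmbedding.conjugate τ) :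
    ∃ Φ : CMType K, (Finset.univ.filter fun s : K →+* ℂ => s.comp i = τ ∧ s ∈ Φ.1).card = 1 := by
  have hcc : ∀ s : K →+* ℂ, ComplexEmbedding.conjugate (ComplexEmbedding.conjugate s) = s :=
    ComplexEmbedding.involutive_conjugate K
  -- an embedding over `τ`
  obtain ⟨sP, hsP⟩ : ∃ s : K →+* ℂ, s.comp i = τ := by
    have h4 := card_filter_comp_eq_four i h8 h2 τ
    obtain ⟨s, hs⟩ := Finset.card_pos.1 (by rw [h4]; norm_num :
      0 < (Finset.univ.filter fun s : K →+* ℂ => s.comp i = τ).card)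
    exact ⟨s, (Finset.mem_filter.1 hs).2⟩
  have hover : ∀ s : K →+* ℂ, ¬ s.comp i = τ ↔ (ComplexEmbedding.conjugate s).comp i = τ := by
    intro s
    rw [conjugate_comp]
    constructor
    · intro h; rw [(hk (s.comp i)).resolve_left h]; exact ComplexEmbedding.involutive_conjugate k τ
    · intro h h'; rw [h'] at h; exact hττ h
  refine ⟨⟨{s | (s.comp i = τ ∧ s = sP) ∨ (¬ s.comp i = τ ∧ s ≠ ComplexEmbedding.conjugate sP)}, fun s => ?_⟩, ?_⟩
  · -- the CM-type property
    simp only [Set.mem_setOf_eq]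
    by_cases h : s.comp i = τ
    · have h' : ¬ (ComplexEmbedding.conjugate s).comp i = τ := by rw [conjugate_comp, h]; exact hττ
      constructor
      · rintro (⟨-, rfl⟩ | ⟨hn, -⟩)
        · rintro (⟨hc, -⟩ | ⟨-, hne⟩)
          · exact h' hc
          · exact hne rfl
        · exact absurd h hn
      · intro hn
        left
        refine ⟨h, ?_⟩
        by_contra hne
        exact hn (Or.inr ⟨h', fun heq => hne (ComplexEmbedding.involutive_conjugate K |>.injective heq)⟩)
    · have h' : (ComplexEmbedding.conjugate s).comp i = τ := (hover s).1 h
      constructor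
      · rintro (⟨hc, -⟩ | ⟨-, hne⟩)
        · exact absurd hc h
        · rintro (⟨-, heq⟩ | ⟨hn, -⟩)
          · exact hne (by rw [← heq, hcc])
          · exact hn h'
      · intro hn
        right
        refine ⟨h, fun heq => hn (Or.inl ⟨h', by rw [heq, hcc]⟩)⟩
  · -- the count over `τ`
    rw [Finset.card_eq_one]
    refine ⟨sP, Finset.ext fun s => ?_⟩
    simp only [Finset.mem_filter, Finset.mem_univ, true_and, Set.mem_setOf_eq, Finset.mem_singleton]
    constructor
    · rintro ⟨hs, (⟨-, rfl⟩ | ⟨hn, -⟩)⟩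
      · rfl
      · exact absurd hs hn
    · rintro rfl; exact ⟨hsP, Or.inl ⟨hsP, rfl⟩⟩

omit [IsCMField k] in
/-- **NON-VACUITY.**  For every CM field `K` of degree `8`, every quadratic CM field `k` with `i : k → K`, and every CM
elliptic curve `E ⊨ (k; Ψ)` and `τ : k → ℂ`, there ARE a CM type `Φ` of `k`-signature `(1,3)` and a CM abelian fourfold
`B ⊨ (K; Φ)` (the tree's theorem `CorCM.cmAbelianVarietyRealised_holds`: every CM type is realised) — so the theorems of
`CorCM/OcticCurveFourfoldHodgeOfMarkman` and of this file quantify over an inhabited family. [cite: Shimura1998, §6.2 Thm. 3] -/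
theorem exists_fourfold_of_signature_one_three (h8 : Module.finrank ℚ K = 8) (h2 : Module.finrank ℚ k = 2) (i : k →+* K)
    (Ψ : CMType k) (τ : k →+* ℂ) :
    ∃ (Φ : CMType K) (B : AbelianVariety ℂ) (ιB : 𝓞 K →+* End B) (θB : K →+* Module.End ℂ (complexBetti B.X 1)),
      IsCMTypeRealisation Φ B ιB θB ∧ (Finset.univ.filter fun s : K →+* ℂ => s.comp i = τ ∧ s ∈ Φ.1).card = 1 := by
  obtain ⟨Φ, hΦ⟩ := exists_cmType_card_filter_eq_one h8 h2 i (Pohlmann1968.conjugate_ne_self Ψ τ)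
    fun σ => Multiquadratic.eq_or_eq_conjugate Ψ h2 τ σ
  obtain ⟨B, ιB, θB, hB⟩ := Summit.HodgeConjecture.CorCM.cmAbelianVarietyRealised_holds K Φ
  exact ⟨Φ, B, ιB, θB, hB, hΦ⟩

end NonVacuity

end Summit.HodgeConjecture.CorCM.OcticCurveFourfold

end
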